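import Literature.Barriers.HodgeConjecture.IntegralCoefficients
import Literature.AlgebraicTopology.SingularHomology.CohomologyOperations
import HarnessLib

/-!
# Atiyah–Hirzebruch (1962): the cohomology-operation mechanism behind the integral Hodge counterexample

Sibling proofs file of `Literature/Barriers/HodgeConjecture/IntegralCoefficients.lean` (D-0021
catalogue), for the barrier fact `AtiyahHirzebruch1962_torsionClass_notAlgebraic`
(Atiyah–Hirzebruch, *Analytic cycles on complex manifolds*, Topology 1 (1962), Thm. 6.5 with
Remark (1)). It PROVES the last step of the printed proof (pp. 40–43) — from the two printed
properties of the operation `δ𝒫¹_p` to "this class is not complex analytic" — for an ARBITRARY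
additive integral cohomology operation, and fixes the printed shape of that operation; it
introduces NO named fact (the barrier fact itself is the single unproved fact of the catalogue
entry; its cut along the printed proof, Prop. 6.6 ∧ (Thm. 6.1 ∧ Prop. 6.7), is the sequel
`…IntegralCoefficientsClassifyingSpace`). The printed proof is:

* Thm. 6.1 (p. 40): "Let `X` be a complex manifold, and let `y ∈ H²q(X; ℤ)` be complex analytic.
  Then `d_r y = 0` for all `r` … In particular for each prime `p`, `δ𝒫¹_p(y) = 0`", where
  (Remark, p. 40) "`𝒫¹_p` is considered here as a homomorphism `H²q(X, ℤ) → H^{2q+2p-2}(X; ℤ_p)`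
  and, for `p = 2`, `δ𝒫¹₂` is to be interpreted as `Sq³`"; `δ` is the integral Bockstein of
  `0 → ℤ → ℤ → ℤ_p → 0`. For `X` compact, `ℋ* = H*` (Remark after 6.2, p. 40).
* Thm. 6.5 (p. 41): "For any prime `p` there exists a projective algebraic manifold `X` and a
  cohomology class `y ∈ H²q(X; ℤ)` such that (i) `δ𝒫¹_p(y) ≠ 0`, (ii) `y` is of order `p`. This
  class is not complex analytic." (from Prop. 6.6, Serre's varieties with the `n`-type of
  `K(ℤ, 2) × K(G, 1)`, and Prop. 6.7, `G = ℤ_p³`, `y = β(u₁u₂u₃) ∈ H⁴(G; ℤ)`); Remark (1), p. 42: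
  "The element `y` constructed in the proof of (6.5) was of dimension 4."
* Assembly: (i) and Thm. 6.1 give "not complex analytic"; with §5 ((5.3)–(5.6): `H²q(X, X - Y; ℤ)`
  is generated by the canonical generators of the codimension-`q` components, mapping to their
  classes) "complex analytic" = "supported on a Zariski-closed subset of codimension `≥ q`", the
  rendering `integralAlgebraicClasses X 2 = N² H⁴(X(ℂ); ℤ)` of the barrier file.

This file states the two printed theorems as PREDICATES on an additive integral cohomology
operation `θ : H⁴(-; ℤ) → Hᵏ(-; ℤ)` (`…SingularHomology.AddCohomologyOperation`, Hatcher §4.L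
p. 488) — `VanishesOnSupportedClasses θ` (what Thm. 6.1 + §5 say of `θ = δ𝒫¹ρ`) and
`DetectsTorsionClass ℓ θ` (what Thm. 6.5 (i), (ii) + Remark (1) say of it) —, fixes the printed
SHAPE of the operation, `bocksteinSandwich ℓ P = β̃_ℓ ∘ P ∘ ρ_ℓ : H⁴(-; ℤ) → H⁴(-; ℤ/ℓ) →
H^{2ℓ+2}(-; ℤ/ℓ) → H^{2ℓ+3}(-; ℤ)` with the tree's real reduction `reduceMod` and integral
Bockstein `integralBockstein` around an additive mod-`ℓ` operation `P` of degree `2ℓ - 2` (the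
slot of `𝒫¹_ℓ`, resp. `Sq²` for `ℓ = 2`; the tree's `steenrodSq` of `…SteenrodSquares` lives on
`singularCohomology R R` for rings `R` of characteristic two and does not provide `𝒫¹_ℓ` for odd
`ℓ`), and PROVES the assembly: additivity carries the vanishing from the generating kernels to
their span `N²H⁴` (`VanishesOnSupportedClasses.apply_eq_zero_of_mem`), `θ y ≠ 0` forces `y ≠ 0`
and `y ∉ N²H⁴` (`exists_torsionClass_notAlgebraic_of_detects`, one prime, any operation), whence
the barrier fact from the two properties for every prime
(`AtiyahHirzebruch1962_torsionClass_notAlgebraic_of_obstruction`, hypotheses explicit).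

What remains for the discharge `AtiyahHirzebruch1962_torsionClass_notAlgebraic_holds` (each a
theory absent from Mathlib and the tree; recorded, not attempted): (a) Steenrod reduced powers
`𝒫¹_ℓ` on `singularCohomology ℤ (ZMod ℓ)` (Hatcher §4.L (1)–(6), Thm. 4L.12/4L.16); (b) Thm. 6.1
for `P = 𝒫¹` (Prop. 6.2: topological `K`-theory with supports of coherent real-analytic sheaves,
§§2–4; the spectral sequence `H* ⇒ K*` and Prop. 7.2 `d_{2p-1} = -δ𝒫¹` mod prime-to-`p`, proved
from Cartan's `H*(K(ℤ, n); ℤ)`, §7; or the Riemann–Roch-for-operations / `MU` alternatives of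
Atiyah–Hirzebruch 1961 and Totaro 1997); (c) Prop. 6.6 (Serre's projective algebraic manifolds
`Y/G` with the `n`-type of `K(ℤ,2) × K(G,1)`: free actions on complete intersections, Lefschetz in
Bott's form, comparison with `ComplexPoints`); (d) Prop. 6.7 (`H*(ℤ_p³; ℤ_p)`, Künneth,
`𝒫¹β(u₁u₂u₃) ≠ 0`); and, inside (a)–(b), the identification of the kernels of restriction with
`Σ ℤ·cl(Zⱼ)` (Fulton, Lemma 19.1.1).

## References

* [AtiyahHirzebruchTopology1962] M. F. Atiyah, F. Hirzebruch, *Analytic cycles on complex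
  manifolds*, Topology 1 (1962) 25–45: Thm. 6.1 and Remark (p. 40), Thm. 6.5, Prop. 6.6, 6.7
  (p. 41), Remarks (1), (3) (pp. 42–43), Prop. 7.1, 7.2 (p. 43), §5 (5.3)–(5.6) (pp. 38–40).
* [HatcherAT2002] A. Hatcher, *Algebraic Topology*, §4.L p. 488 (cohomology operations), §3.E.
* [Fulton1998] W. Fulton, *Intersection Theory*, §19.1, Lemma 19.1.1 (`H₂ₖ(Z) ` free on the
  `k`-dimensional components; used for `N² H⁴ = Σ ℤ·cl(Z)` as in the barrier file).
-/
noncomputable section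

open CategoryTheory AlgebraicGeometry
open Literature.AlgebraicTopology.SingularHomology (AddCohomologyOperation)
open Literature.AlgebraicGeometry.Motives (SchemeOver IsSmoothProjective bettiCohomologyInt
  ComplexPoints)

namespace Literature.Barriers.HodgeConjecture

section Barriers
section HodgeConjecture

variable {k : ℕ}

/-! ### The two printed theorems as predicates on an integral operation of source degree 4 -/

/-- What Atiyah–Hirzebruch's Thm. 6.1 (with §5 and the Remark `ℋ* = H*` for compact `X`, p. 40)
asserts of the operation `θ = δ𝒫¹_p ρ_p` on `H⁴(-; ℤ)`, as a predicate on an arbitrary additive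
integral cohomology operation `θ : H⁴(-; ℤ) → Hᵏ(-; ℤ)`: for every smooth projective complex
variety `X` and every Zariski-closed `Z ⊆ X` all of whose points have codimension `≥ 2`, `θ_{X(ℂ)}`
annihilates every class `y ∈ H⁴(X(ℂ); ℤ)` restricting to `0` on `(X ∖ Z)(ℂ)` — such `y` being
exactly the integral combinations of the classes of the codimension-`2` components of `Z`
("complex analytic classes", §5 (5.3)–(5.6) and §6 p. 40; Fulton, Lemma 19.1.1), on which
`δ𝒫¹_p` vanishes by Thm. 6.1. The generators here are those of the barrier file's
`integralSupportedClasses X (2 * 2) 2 = integralAlgebraicClasses X 2`.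
[cite: AtiyahHirzebruchTopology1962, Thm. 6.1 and Remark p. 40, §5 (5.3)–(5.6)] -/
def VanishesOnSupportedClasses (θ : AddCohomologyOperation.{0} ℤ ℤ ℤ (2 * 2) k) : Prop :=
  ∀ ⦃n : ℕ⦄ ⦃X : SchemeOver ℂ⦄, IsSmoothProjective n X →
    ∀ ⦃Z : Set X.left⦄, IsClosed Z → (∀ z ∈ Z, ((2 : ℕ) : ℕ∞) ≤ Order.coheight z) →
      ∀ y : bettiCohomologyInt X (2 * 2), restrictComplInt X Z (2 * 2) y = 0 →
        θ.app (ComplexPoints X) y = 0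

/-- What Atiyah–Hirzebruch's Thm. 6.5 (i), (ii) with Remark (1) ("the element `y` … was of
dimension 4") assert of `θ = δ𝒫¹_ℓ ρ_ℓ`, as a predicate on an additive integral operation
`θ : H⁴(-; ℤ) → Hᵏ(-; ℤ)`: there are a projective algebraic manifold `X` (a smooth projective
complex variety, of some dimension `n`) and a class `y ∈ H⁴(X(ℂ); ℤ)` with `ℓ • y = 0` ("of order
`p`"; `y ≠ 0` follows from `θ y ≠ 0`) and `θ_{X(ℂ)} y ≠ 0` ("`δ𝒫¹_p(y) ≠ 0`").
[cite: AtiyahHirzebruchTopology1962, Thm. 6.5 (i)–(ii) p. 41 and Remark (1) p. 42] -/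
def DetectsTorsionClass (ℓ : ℕ) (θ : AddCohomologyOperation.{0} ℤ ℤ ℤ (2 * 2) k) : Prop :=
  ∃ (n : ℕ) (X : SchemeOver ℂ) (_ : IsSmoothProjective n X) (y : bettiCohomologyInt X (2 * 2)),
    (ℓ : ℤ) • y = 0 ∧ θ.app (ComplexPoints X) y ≠ 0

/-- The SHAPE of Atiyah–Hirzebruch's obstruction operation on `H⁴(-; ℤ)` for the prime `ℓ`:
`δ 𝒫¹_ℓ ρ_ℓ : H⁴(-; ℤ) →ρ H⁴(-; ℤ/ℓ) →P H^{2ℓ+2}(-; ℤ/ℓ) →β̃ H^{2ℓ+3}(-; ℤ)` ("`𝒫¹_p` is considered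
here as a homomorphism `H²q(X, ℤ) → H^{2q+2p-2}(X; ℤ_p)`", followed by the integral Bockstein `δ`;
for `ℓ = 2` the middle slot is `Sq²`, and Atiyah–Hirzebruch write `Sq³` for `δSq²ρ₂`, whose
reduction mod `2` is `Sq¹Sq² = Sq³`), built from the tree's real `reduceMod` and
`integralBockstein` (as operations, `…CohomologyOperations`) around an ARBITRARY
additive mod-`ℓ` operation `P` of degree `2ℓ - 2` occupying the slot of the reduced power `𝒫¹_ℓ`,
which the tree does not have. `NeZero ℓ` is derived from primality inside the definition.
[cite: AtiyahHirzebruchTopology1962, Thm. 6.1 Remark p. 40] -/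
def bocksteinSandwich {ℓ : ℕ} (hℓ : ℓ.Prime)
    (P : AddCohomologyOperation.{0} ℤ (ZMod ℓ) (ZMod ℓ) (2 * 2) (2 * ℓ + 2)) :
    AddCohomologyOperation.{0} ℤ ℤ ℤ (2 * 2) (2 * ℓ + 2 + 1) :=
  haveI : NeZero ℓ := ⟨hℓ.ne_zero⟩
  (AddCohomologyOperation.integralBockstein ℓ (2 * ℓ + 2)).comp
    (P.comp (AddCohomologyOperation.reduceMod ℓ (2 * 2)))

/-- Unfolding `bocksteinSandwich`: `(β̃ ∘ P ∘ ρ)_E y = β̃_E (P_E (ρ_E y))`.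
[cite: AtiyahHirzebruchTopology1962, Thm. 6.1 Remark p. 40] -/
lemma bocksteinSandwich_app {ℓ : ℕ} (hℓ : ℓ.Prime)
    (P : AddCohomologyOperation.{0} ℤ (ZMod ℓ) (ZMod ℓ) (2 * 2) (2 * ℓ + 2))
    (E : Type) [TopologicalSpace E]
    (y : Literature.AlgebraicTopology.SingularHomology.singularCohomology ℤ ℤ E (2 * 2)) :
    (bocksteinSandwich hℓ P).app E y =
      haveI : NeZero ℓ := ⟨hℓ.ne_zero⟩
      Literature.AlgebraicTopology.SingularHomology.integralBockstein E ℓ (2 * ℓ + 2)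
        (P.app E (Literature.AlgebraicTopology.SingularHomology.reduceMod E ℓ (2 * 2) y)) :=
  rfl

/-! ### Proved: from the generating kernels to `N² H⁴`, and the assembly -/

/-- An additive operation that kills the generators of the support filtration kills the whole of
`N² H⁴(X(ℂ); ℤ) = integralAlgebraicClasses X 2`: the classes on which `θ_{X(ℂ)}` vanishes form a
subgroup, and `N²H⁴` is the subgroup generated by the kernels of the restrictions to complements
of codimension-`≥ 2` closed subsets (this is how Thm. 6.1, stated for the classes of irreducible
subspaces, extends to their integral combinations `Σ nᵢ yᵢ`, §6 p. 40).
[cite: AtiyahHirzebruchTopology1962, Thm. 6.1 and §6 p. 40] -/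
theorem VanishesOnSupportedClasses.apply_eq_zero_of_mem
    {θ : AddCohomologyOperation.{0} ℤ ℤ ℤ (2 * 2) k} (hθ : VanishesOnSupportedClasses θ)
    {n : ℕ} {X : SchemeOver ℂ} (hX : IsSmoothProjective n X) {y : bettiCohomologyInt X (2 * 2)}
    (hy : y ∈ integralAlgebraicClasses X 2) : θ.app (ComplexPoints X) y = 0 := by
  change y ∈ ⨆ (Z : Set X.left) (_ : IsClosed Z) (_ : ∀ z ∈ Z, ((2 : ℕ) : ℕ∞) ≤ Order.coheight z),
    LinearMap.ker (restrictComplInt X Z (2 * 2)).hom at hy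
  refine Submodule.iSup_induction _ (motive := fun y ↦ θ.app (ComplexPoints X) y = 0) hy
    (fun Z a ha ↦ ?_) θ.map_zero (fun a b ha hb ↦ by rw [θ.map_add, ha, hb, add_zero])
  refine Submodule.iSup_induction _ (motive := fun y ↦ θ.app (ComplexPoints X) y = 0) ha
    (fun hZ b hb ↦ ?_) θ.map_zero (fun a b ha hb ↦ by rw [θ.map_add, ha, hb, add_zero])
  refine Submodule.iSup_induction _ (motive := fun y ↦ θ.app (ComplexPoints X) y = 0) hb
    (fun hr c hc ↦ ?_) θ.map_zero (fun a b ha hb ↦ by rw [θ.map_add, ha, hb, add_zero])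
  exact hθ hX hZ hr c (LinearMap.mem_ker.1 hc)

/-- Contrapositive form used in the assembly: a class detected by an operation vanishing on
supported classes is not an integral algebraic class ("This class is not complex analytic",
Thm. 6.5). [cite: AtiyahHirzebruchTopology1962, Thm. 6.5 p. 41] -/
theorem VanishesOnSupportedClasses.not_mem_integralAlgebraicClasses
    {θ : AddCohomologyOperation.{0} ℤ ℤ ℤ (2 * 2) k} (hθ : VanishesOnSupportedClasses θ)
    {n : ℕ} {X : SchemeOver ℂ} (hX : IsSmoothProjective n X) {y : bettiCohomologyInt X (2 * 2)}
    (hy : θ.app (ComplexPoints X) y ≠ 0) : y ∉ integralAlgebraicClasses X 2 :=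
  fun h ↦ hy (hθ.apply_eq_zero_of_mem hX h)

/-- **The last step of the proof of Thm. 6.5, one prime (proved).** If an additive integral
operation `θ : H⁴(-; ℤ) → Hᵏ(-; ℤ)` vanishes on supported classes (what Thm. 6.1 says of
`δ𝒫¹_ℓ`) and detects a class `y ∈ H⁴(X(ℂ); ℤ)` with `ℓ • y = 0` on a projective algebraic manifold
`X` (Thm. 6.5 (i) "`δ𝒫¹_p(y) ≠ 0`", (ii) "`y` is of order `p`"), then `y` is a nonzero `ℓ`-torsion
class outside `N² H⁴ = integralAlgebraicClasses X 2` ("This class is not complex analytic"):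
`y ≠ 0` because `θ` is additive and `θ y ≠ 0`, and `y ∉ N² H⁴` by
`VanishesOnSupportedClasses.not_mem_integralAlgebraicClasses`.
[cite: AtiyahHirzebruchTopology1962, Thm. 6.5 p. 41] -/
theorem exists_torsionClass_notAlgebraic_of_detects {ℓ : ℕ}
    {θ : AddCohomologyOperation.{0} ℤ ℤ ℤ (2 * 2) k} (hV : VanishesOnSupportedClasses θ)
    (hD : DetectsTorsionClass ℓ θ) :
    ∃ (n : ℕ) (X : SchemeOver ℂ) (_ : IsSmoothProjective n X) (y : bettiCohomologyInt X (2 * 2)),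
      y ≠ 0 ∧ (ℓ : ℤ) • y = 0 ∧ y ∉ integralAlgebraicClasses X 2 := by
  obtain ⟨n, X, hX, y, hy, hθ⟩ := hD
  refine ⟨n, X, hX, y, ?_, hy, hV.not_mem_integralAlgebraicClasses hX hθ⟩
  rintro rfl
  exact hθ (AddCohomologyOperation.map_zero _)

/-- **Assembly (proved, hypotheses explicit): the two printed properties of `δ𝒫¹_ℓ`, for every
prime `ℓ`, imply the barrier fact.** If for every prime `ℓ` some additive integral operation on
`H⁴(-; ℤ)` (in print `θ = δ𝒫¹_ℓ ρ_ℓ`, of shape `bocksteinSandwich`; "`Sq³`" for `ℓ = 2`) both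
vanishes on supported classes (Thm. 6.1 with §5) and detects an `ℓ`-torsion class on a projective
algebraic manifold (Thm. 6.5 (i)(ii), from Prop. 6.6 and 6.7; Remark (1): `y` of dimension 4),
then `AtiyahHirzebruch1962_torsionClass_notAlgebraic` holds (Thm. 6.5 "this class is not complex
analytic"; Remark (3): "Hodge's conjecture is not true for cohomology classes of higher
dimension"). This is the last step of the printed proof; the discharge of the barrier fact is
thereby reduced to constructing `𝒫¹_ℓ` and proving Thm. 6.1, Prop. 6.6 and Prop. 6.7 for it.
[cite: AtiyahHirzebruchTopology1962, Thm. 6.5 p. 41 and Remark (3) p. 43] -/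
theorem AtiyahHirzebruch1962_torsionClass_notAlgebraic_of_obstruction
    (h : ∀ ⦃ℓ : ℕ⦄, ℓ.Prime → ∃ (k : ℕ) (θ : AddCohomologyOperation.{0} ℤ ℤ ℤ (2 * 2) k),
      VanishesOnSupportedClasses θ ∧ DetectsTorsionClass ℓ θ) :
    AtiyahHirzebruch1962_torsionClass_notAlgebraic := by
  intro ℓ hℓ
  obtain ⟨k, θ, hV, hD⟩ := h hℓ
  exact exists_torsionClass_notAlgebraic_of_detects hV hD

/-- The same assembly for operations of the printed shape `β̃_ℓ ∘ P ∘ ρ_ℓ` (`bocksteinSandwich`;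
in print `P = 𝒫¹_ℓ`): the form in which the sequel `…IntegralCoefficientsClassifyingSpace`
delivers Thm. 6.1 ∧ Thm. 6.5 (i)(ii) from Prop. 6.6 and Prop. 6.7.
[cite: AtiyahHirzebruchTopology1962, Thm. 6.5 p. 41] -/
theorem AtiyahHirzebruch1962_torsionClass_notAlgebraic_of_bocksteinSandwich
    (h : ∀ ⦃ℓ : ℕ⦄ (hℓ : ℓ.Prime),
      ∃ P : AddCohomologyOperation.{0} ℤ (ZMod ℓ) (ZMod ℓ) (2 * 2) (2 * ℓ + 2),
        VanishesOnSupportedClasses (bocksteinSandwich hℓ P) ∧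
          DetectsTorsionClass ℓ (bocksteinSandwich hℓ P)) :
    AtiyahHirzebruch1962_torsionClass_notAlgebraic :=
  AtiyahHirzebruch1962_torsionClass_notAlgebraic_of_obstruction fun _ hℓ ↦
    let ⟨P, hV, hD⟩ := h hℓ; ⟨_, bocksteinSandwich hℓ P, hV, hD⟩

/-- The obstruction operation is `ℓ`-torsion-valued on reductions: `β̃_ℓ ∘ ρ_ℓ = 0`, so
`bocksteinSandwich hℓ P` kills every class `y` with `P (ρ y) = ρ y'` a reduction of an integral
class — the form in which Thm. 6.1 is usually proved (`𝒫¹ cl(Z)` is the reduction of an integral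
class). A sanity check that the sandwich composes the tree's real Bockstein maps.
[cite: AtiyahHirzebruchTopology1962, Thm. 6.1 Remark p. 40] -/
theorem bocksteinSandwich_app_eq_zero_of_eq_reduceMod {ℓ : ℕ} (hℓ : ℓ.Prime)
    (P : AddCohomologyOperation.{0} ℤ (ZMod ℓ) (ZMod ℓ) (2 * 2) (2 * ℓ + 2))
    {E : Type} [TopologicalSpace E]
    {y : Literature.AlgebraicTopology.SingularHomology.singularCohomology ℤ ℤ E (2 * 2)}
    {y' : Literature.AlgebraicTopology.SingularHomology.singularCohomology ℤ ℤ E (2 * ℓ + 2)}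
    (h : haveI : NeZero ℓ := ⟨hℓ.ne_zero⟩
      P.app E (Literature.AlgebraicTopology.SingularHomology.reduceMod E ℓ (2 * 2) y) =
        Literature.AlgebraicTopology.SingularHomology.reduceMod E ℓ (2 * ℓ + 2) y') :
    (bocksteinSandwich hℓ P).app E y = 0 := by
  haveI : NeZero ℓ := ⟨hℓ.ne_zero⟩
  rw [bocksteinSandwich_app]
  change Literature.AlgebraicTopology.SingularHomology.integralBockstein E ℓ (2 * ℓ + 2)
    (P.app E (Literature.AlgebraicTopology.SingularHomology.reduceMod E ℓ (2 * 2) y)) = 0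
  rw [h]
  exact AddCohomologyOperation.integralBockstein_app_reduceMod_app ℓ (2 * ℓ + 2) y'

end HodgeConjecture
end Barriers

end Literature.Barriers.HodgeConjecture

end
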